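import Summits.CriticalPhenomena.PercolationContinuityZ3.Theorems.PercNearOneGluingNoHeavyQuantGateStepNFree
import Summits.CriticalPhenomena.PercolationContinuityZ3.Theorems.PercNearOneGluingNoHeavyQuantGatedSliceMixLawNodeHolds
import HarnessLib

/-!
# QUANT lane R8, T-DEC: THE SIBLING STEP — the open core of the gate-elimination induction as ONE node on forests of
# `k ≥ 3` COMPOSITE sibling trees (`LawDec.SiblingStep`), with the kernel skeleton
# `GatedSliceMixLaw' ∧ SiblingStep ⟹ (every tree-built law is SDEC) ⟹ GateStepN ⟹ SDECConvClosedTB ⟹ FarTreeRow`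

builds on p205010 (kernel theorem, internal audit signed; external expert review pending)

Statement + support file (`--supports stmt-CriticalPhenomena-4575`), QUANT lane typer seat prim-quant-stmt (gen 39), rung R8 of
`run/shared/lean/prim/quant/LADDER.md`; the node spec is lead g42's LEAD-NOTES-G42 N4 (2)–(3) / README V394 (e), V397 ("OPEN CORE in one
sentence: a sibling group with ≥ 3 COMPOSITE members under the SDEC quantifier").  Two inductive predicates (`LawDec.CompForestN`,
`LawDec.BlobForest`), one `@[conjecture]` (`LawDec.SiblingStep`); theorems with standard axioms, no sorries.  Continues lead g42's
`…QuantGateStepN` (`TreeBuiltN`, `GateStepN`, `sdec_of_treeBuiltN`) and `…QuantGateStepNFree` (`gateStepN_of_tree` = arm-1 g45's two-root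
identity fed by the oracle, `GateStepNCore`), and the lane's blob gate step CW (`sdec_slice_blob_of_mixLaw'`, node `GatedSliceMixLaw'` — a
theorem of the tree, `gatedSliceMixLaw'_holds` ✓ p373052, module `…GatedSliceMixLawNodeHolds` — built on the check farm since
2026-08-25, cf. typer g39's `…QuantGateStepNCoreHolds` ✓ p396323; the skeleton is stated with the hypothesis `hL` as in
`…QuantGateStepNFree` AND discharged in the primed corollaries at the end).

WHY.  `GateStepNCore` (✓ p394054) restricts the environment to "a convolution `a ∗ b`", which is no restriction (`a = δ₀`; ARM-REF g133
N2).  The genuine open core (README V393/V397) is a SIBLING GROUP WITH ≥ 3 COMPOSITE MEMBERS: blob / relay siblings are absorbed by the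
slice theorems, one or two composite siblings by `sdec_gate` / the two-root identity.  This file types that and proves the absorption:
* `LawDec.CompForestN x n M μ k` — `μ` on `{0..M}` is the convolution of `k` COMPOSITE sibling trees at floor `x`: `gate ρᵢ qᵢ` with
  `0 < qᵢ < 1`, `ρᵢ` tree-built (`TreeBuiltN xᵢ nᵢ Mᵢ ρᵢ`) at a floor `xᵢ` with `x ≤ qᵢ·xᵢ`, and `ρᵢ` NOT a point mass; `n = Σ (nᵢ + 1)`.
* `LawDec.BlobForest x M μ` — `μ` is the convolution of BLOB siblings `gate δ_K q` (`x ≤ q·x₁ ≤ q ≤ 1`; `q = 1`, `K = 1` is a sure relay).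
* `TreeBuiltN.partition` — EVERY tree-built law is `μ_C ∗ μ_B` with `μ_C` a composite forest (gate count `≤ n`) and `μ_B` a blob forest
  (forest normal form: `lconv_assoc` / `lconv_comm` / the interchange law `lconv_interchange`).
* **`@[conjecture] LawDec.SiblingStep`** (THE NODE): for `k ≥ 3` and `CompForestN x n M μ k`, IF every `TreeBuiltN` law with `< n` nontrivial
  gates is SDEC at its floor (the induction hypothesis: it covers every proper sub-forest, every opened / re-gated / re-hung version), THEN
  `SDEC x M μ`.
* `sdec_compForestN_of_siblingStep` — under the oracle below a budget `N ≥ n`: a composite forest is SDEC (width 0: trivial; width 1: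
  oracle + `sdec_gate`; width 2: `gateStepN_of_tree`; width ≥ 3: the node); `sdec_lconv_blobForest` — beside an SDEC tree-built law every blob
  forest is absorbed (`sdec_slice_blob_of_mixLaw'`, given `GatedSliceMixLaw'`); hence **`sdec_of_treeBuiltN_of_siblingStep :
  GatedSliceMixLaw' → SiblingStep → TreeBuiltN x n M μ → SDEC x M μ`** (strong induction on the gate count).
* **`gateStepN_of_siblingStep : GatedSliceMixLaw' → SiblingStep → GateStepN`**, `siblingStep_of_gateStepN`, **`siblingStep_of_gateStepNCore`**
  (the sibling step is implied by the core node, hence is the WEAKEST node of the lane), `sdecConvClosedTB_of_siblingStep`,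
  `treeBuiltDEC_of_siblingStep`, **`Quant.farTreeRow_of_siblingStep : GatedSliceMixLaw' → SiblingStep → FarTreeRow`**.
* UNCONDITIONAL forms (CW fed in: `gatedSliceMixLaw'_holds`): `sdec_of_treeBuiltN_of_siblingStep'`, `gateStepN_of_siblingStep'`,
  **`siblingStep_iff_gateStepN`**, **`siblingStep_iff_gateStepNCore`**, `sdecConvClosedTB_of_siblingStep'`,
  **`Quant.farTreeRow_of_siblingStep' : LawDec.SiblingStep → FarTreeRow`**.

So, in the kernel and without side hypotheses: `FarTreeRow ⟸ SiblingStep ⟺ GateStepN ⟺ GateStepNCore` (`⟹ SDECConvClosedTB`).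
MINIMAL OPEN INSTANCE (README V393): three 2-chains, `k = 3`.  EVIDENCE: RCM census 0 / ≈ 11 500 (README V394–V400), pattern level
generic-feasible (V405), the cherry identity (V404/V406).  HONEST STATUS: `SiblingStep`, `GateStepN`, `FarTreeRow` OPEN; the RATE class
log\* and the honest sentence of `run/shared/lean/prim/quant/README.md` are unchanged.
[this work]; `TreeBuiltN`/`GateStepN(Core)`: prim-quant-lead g42; two-root identity: prim-quant-arm-1 g45; CW: this lane (gens 29–36); SDEC /
`TreeBuilt`: prim-quant-census-2 g53.  Nothing here is cited as a published result.  The gluing rows served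
[cite: KozmaNitzan2024, Conjecture 3 (p. 15)]; product measure [cite: Grimmett1999, §1.3 p. 10].
-/

noncomputable section

namespace Summit.CriticalPhenomena.PercolationContinuityZ3.Theorems
namespace Quant
namespace LawDec

/-- **interchange**: `(a ∗ b) ∗ (c ∗ d) = (a ∗ c) ∗ (b ∗ d)` with the top indices (from `lconv_assoc`, `lconv_comm`; no hypotheses). [this work] -/
theorem lconv_interchange (A B C D : ℕ) (a b c d : ℕ → ℝ) :
    lconv (A + B) (C + D) (lconv A B a b) (lconv C D c d) = lconv (A + C) (B + D) (lconv A C a c) (lconv B D b d) := by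
  have h1 : lconv (A + B) C (lconv A B a b) c = lconv (A + C) B (lconv A C a c) b := by
    rw [← lconv_assoc A B C a b c, lconv_comm B C b c, Nat.add_comm B C, lconv_assoc A C B a c b]
  rw [lconv_assoc (A + B) C D, h1, show A + B + C = A + C + B by omega, ← lconv_assoc (A + C) B D]

/-- **A forest of `k` COMPOSITE sibling trees at floor `x`**: `CompForestN x n M μ k` — `μ` on `{0..M}` is `δ₀` convolved successively with
`k` laws `gate ρᵢ qᵢ` (`0 < qᵢ < 1`), each `ρᵢ` tree-built with `nᵢ` nontrivial gates (`TreeBuiltN xᵢ nᵢ Mᵢ ρᵢ`) at a floor `xᵢ` with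
`x ≤ qᵢ·xᵢ`, and `ρᵢ` NOT a point mass (the sibling is not a blob / relay); `n = Σᵢ (nᵢ + 1)`, `M = Σᵢ Mᵢ`.  Tree reading: `k` sibling
trees whose sub-forests have at least two atoms each, every vertex marginal `≥ x`. [this work] -/
inductive CompForestN : ℝ → ℕ → ℕ → (ℕ → ℝ) → ℕ → Prop
  | nil (x : ℝ) (hx0 : 0 < x) (hx1 : x < 1) : CompForestN x 0 0 (fun h => if h = 0 then (1 : ℝ) else 0) 0
  | tree {x : ℝ} {n M k : ℕ} {μ : ℕ → ℝ} (hF : CompForestN x n M μ k) {x₁ : ℝ} {n₁ M₁ : ℕ} {ρ : ℕ → ℝ}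
      (q : ℝ) (hq0 : 0 < q) (hq1 : q < 1) (hxq : x ≤ q * x₁) (hρ : TreeBuiltN x₁ n₁ M₁ ρ)
      (hnp : ∀ K : ℕ, ρ ≠ fun h => if h = K then (1 : ℝ) else 0) :
      CompForestN x (n + (n₁ + 1)) (M + M₁) (lconv M M₁ μ (gate ρ q)) (k + 1)

/-- **A forest of BLOB siblings at floor `x`**: `BlobForest x M μ` — `μ` on `{0..M}` is `δ₀` convolved successively with laws `gate δ_K q`
(`0 < q ≤ 1`, `x ≤ q·x₁` for a floor `x₁` at which `δ_K` is tree-built; `q = 1`, `K = 1`: a sure relay).  [this work] -/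
inductive BlobForest : ℝ → ℕ → (ℕ → ℝ) → Prop
  | nil (x : ℝ) (hx0 : 0 < x) (hx1 : x < 1) : BlobForest x 0 (fun h => if h = 0 then (1 : ℝ) else 0)
  | blob {x : ℝ} {M : ℕ} {μ : ℕ → ℝ} (hF : BlobForest x M μ) {x₁ : ℝ} {n₁ K : ℕ}
      (q : ℝ) (hq0 : 0 < q) (hq1 : q ≤ 1) (hxq : x ≤ q * x₁)
      (hρ : TreeBuiltN x₁ n₁ K (fun h => if h = K then (1 : ℝ) else 0)) :
      BlobForest x (M + K) (lconv M K μ (gate (fun h => if h = K then (1 : ℝ) else 0) q))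

/-- transport of a `CompForestN` certificate along equal indices. [this work] -/
theorem CompForestN.cast {x : ℝ} {n M k n' M' k' : ℕ} {μ μ' : ℕ → ℝ} (h : CompForestN x n M μ k)
    (hn : n = n') (hM : M = M') (hμ : μ = μ') (hk : k = k') : CompForestN x n' M' μ' k' := by
  subst hn hM hμ hk; exact h

/-- transport of a `BlobForest` certificate along equal indices. [this work] -/
theorem BlobForest.cast {x : ℝ} {M M' : ℕ} {μ μ' : ℕ → ℝ} (h : BlobForest x M μ) (hM : M = M') (hμ : μ = μ') :
    BlobForest x M' μ' := by
  subst hM hμ; exact h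

/-- the floor of a composite forest lies in `(0,1)`. [this work] -/
theorem CompForestN.floor {x : ℝ} {n M k : ℕ} {μ : ℕ → ℝ} (h : CompForestN x n M μ k) : 0 < x ∧ x < 1 := by
  induction h with
  | nil hx0 hx1 => exact ⟨hx0, hx1⟩
  | tree _ _ _ _ _ _ _ ih => exact ih

/-- the floor of a blob forest lies in `(0,1)`. [this work] -/
theorem BlobForest.floor {x : ℝ} {M : ℕ} {μ : ℕ → ℝ} (h : BlobForest x M μ) : 0 < x ∧ x < 1 := by
  induction h with
  | nil hx0 hx1 => exact ⟨hx0, hx1⟩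
  | blob _ _ _ _ _ _ ih => exact ih

/-- **a composite forest is tree-built** (with its gate count). [this work] -/
theorem CompForestN.treeBuiltN {x : ℝ} {n M k : ℕ} {μ : ℕ → ℝ} (h : CompForestN x n M μ k) : TreeBuiltN x n M μ := by
  induction h with
  | nil hx0 hx1 => exact TreeBuiltN.nil x hx0 hx1
  | tree hF q hq0 hq1 hxq hρ _ ih =>
    exact TreeBuiltN.conv ih (TreeBuiltN.mono (TreeBuiltN.gate q hq0 hq1 hρ) hF.floor.1 hxq)

/-- **a blob forest is tree-built** (for some gate count). [this work] -/
theorem BlobForest.exists_treeBuiltN {x : ℝ} {M : ℕ} {μ : ℕ → ℝ} (h : BlobForest x M μ) : ∃ n, TreeBuiltN x n M μ := by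
  induction h with
  | nil hx0 hx1 => exact ⟨0, TreeBuiltN.nil x hx0 hx1⟩
  | @blob M₀ μ₀ hF x₁ n₁ K q hq0 hq1 hxq hρ ih =>
    obtain ⟨n, hn⟩ := ih
    have hx0 : 0 < x := hF.floor.1
    rcases eq_or_lt_of_le hq1 with hq | hq
    · subst hq
      rw [gate_one]
      rw [one_mul] at hxq
      exact ⟨n + n₁, TreeBuiltN.conv hn (TreeBuiltN.mono hρ hx0 hxq)⟩
    · exact ⟨n + (n₁ + 1), TreeBuiltN.conv hn (TreeBuiltN.mono (TreeBuiltN.gate q hq0 hq hρ) hx0 hxq)⟩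

/-- floor-lowering of a composite forest. [this work] -/
theorem CompForestN.mono {x x' : ℝ} {n M k : ℕ} {μ : ℕ → ℝ} (h : CompForestN x n M μ k) (hx'0 : 0 < x') (hxx : x' ≤ x) :
    CompForestN x' n M μ k := by
  induction h with
  | nil hx0 hx1 => exact CompForestN.nil x' hx'0 (lt_of_le_of_lt hxx hx1)
  | tree _ q hq0 hq1 hxq hρ hnp ih => exact CompForestN.tree ih q hq0 hq1 (le_trans hxx hxq) hρ hnp

/-- floor-lowering of a blob forest. [this work] -/
theorem BlobForest.mono {x x' : ℝ} {M : ℕ} {μ : ℕ → ℝ} (h : BlobForest x M μ) (hx'0 : 0 < x') (hxx : x' ≤ x) :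
    BlobForest x' M μ := by
  induction h with
  | nil hx0 hx1 => exact BlobForest.nil x' hx'0 (lt_of_le_of_lt hxx hx1)
  | blob _ q hq0 hq1 hxq hρ ih => exact BlobForest.blob ih q hq0 hq1 (le_trans hxx hxq) hρ

/-- **composite forests compose** (`lconv_assoc`). [this work] -/
theorem CompForestN.append {x : ℝ} {n₁ M₁ k₁ : ℕ} {μ₁ : ℕ → ℝ} (h₁ : CompForestN x n₁ M₁ μ₁ k₁)
    {n₂ M₂ k₂ : ℕ} {μ₂ : ℕ → ℝ} (h₂ : CompForestN x n₂ M₂ μ₂ k₂) :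
    CompForestN x (n₁ + n₂) (M₁ + M₂) (lconv M₁ M₂ μ₁ μ₂) (k₁ + k₂) := by
  induction h₂ with
  | nil hx0 hx1 =>
    obtain ⟨_, _, _, h1M, _, _⟩ := h₁.treeBuiltN.lawFacts
    have e : lconv M₁ 0 μ₁ (fun h => if h = 0 then (1 : ℝ) else 0) = μ₁ := funext fun h => lconv_delta_right M₁ 0 μ₁ h1M h
    rw [e]; exact h₁
  | @tree n M k μ _ x₁ n' M' ρ q hq0 hq1 hxq hρ hnp ih =>
    exact (CompForestN.tree ih q hq0 hq1 hxq hρ hnp).cast (by omega) (by omega) (lconv_assoc M₁ M M' μ₁ μ (gate ρ q)).symm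
      (by omega)

/-- **blob forests compose** (`lconv_assoc`). [this work] -/
theorem BlobForest.append {x : ℝ} {M₁ : ℕ} {μ₁ : ℕ → ℝ} (h₁ : BlobForest x M₁ μ₁) {M₂ : ℕ} {μ₂ : ℕ → ℝ} (h₂ : BlobForest x M₂ μ₂) :
    BlobForest x (M₁ + M₂) (lconv M₁ M₂ μ₁ μ₂) := by
  induction h₂ with
  | nil hx0 hx1 =>
    obtain ⟨_, hT⟩ := h₁.exists_treeBuiltN
    obtain ⟨_, _, _, h1M, _, _⟩ := hT.lawFacts
    have e : lconv M₁ 0 μ₁ (fun h => if h = 0 then (1 : ℝ) else 0) = μ₁ := funext fun h => lconv_delta_right M₁ 0 μ₁ h1M h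
    rw [e]; exact h₁
  | @blob M μ _ x₁ n' K q hq0 hq1 hxq hρ ih =>
    exact (BlobForest.blob ih q hq0 hq1 hxq hρ).cast (by omega)
      (lconv_assoc M₁ M K μ₁ μ (gate (fun h => if h = K then (1 : ℝ) else 0) q)).symm

/-- **FOREST NORMAL FORM.**  Every `TreeBuiltN x n M μ` is `μ_C ∗ μ_B` with `μ_C` a forest of composite sibling trees at floor `x` (gate count
`≤ n`) and `μ_B` a blob forest at floor `x`. [this work] -/
theorem TreeBuiltN.partition {x : ℝ} {n M : ℕ} {μ : ℕ → ℝ} (h : TreeBuiltN x n M μ) :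
    ∃ (k nC MC MB : ℕ) (μC μB : ℕ → ℝ), CompForestN x nC MC μC k ∧ BlobForest x MB μB ∧ nC ≤ n ∧ M = MC + MB ∧
      μ = lconv MC MB μC μB := by
  -- (inside `TreeBuiltN.…` the bare name `gate` is the constructor; the law-level gate is written `LawDec.gate`)
  have hv0 : ∀ k, 0 < k → (fun h => if h = 0 then (1 : ℝ) else 0) k = 0 := fun k hk => if_neg (by omega)
  induction h with
  | nil x₀ hx0 hx1 =>
    refine ⟨0, 0, 0, 0, _, _, CompForestN.nil x₀ hx0 hx1, BlobForest.nil x₀ hx0 hx1, le_rfl, rfl, ?_⟩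
    exact funext fun k => (lconv_delta_left 0 0 _ hv0 k).symm
  | relay x₀ hx0 hx1 =>
    have hB : BlobForest x₀ (0 + 1) (lconv 0 1 (fun h => if h = 0 then (1 : ℝ) else 0)
        (LawDec.gate (fun h => if h = 1 then (1 : ℝ) else 0) 1)) :=
      BlobForest.blob (BlobForest.nil x₀ hx0 hx1) 1 one_pos le_rfl (by rw [one_mul]) (TreeBuiltN.relay x₀ hx0 hx1)
    refine ⟨0, 0, 0, 0 + 1, _, _, CompForestN.nil x₀ hx0 hx1, hB, le_rfl, rfl, ?_⟩
    have hv2 : ∀ k, 1 < k → (fun h => if h = 1 then (1 : ℝ) else 0) k = 0 := fun k hk => if_neg (by omega)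
    have hv1 : ∀ k, 0 + 1 < k →
        lconv 0 1 (fun h => if h = 0 then (1 : ℝ) else 0) (fun h => if h = 1 then (1 : ℝ) else 0) k = 0 := by
      intro k hk; rw [lconv_delta_left 0 1 _ hv2 k]; exact hv2 k (by omega)
    funext k
    rw [gate_one, lconv_delta_left 0 (0 + 1) _ hv1 k, lconv_delta_left 0 1 _ hv2 k]
  | @conv x₀ na nb Ma Mb a b _ _ iha ihb =>
    obtain ⟨k₁, nC₁, MC₁, MB₁, μC₁, μB₁, hC₁, hB₁, hn₁, hM₁, hμ₁⟩ := iha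
    obtain ⟨k₂, nC₂, MC₂, MB₂, μC₂, μB₂, hC₂, hB₂, hn₂, hM₂, hμ₂⟩ := ihb
    refine ⟨k₁ + k₂, nC₁ + nC₂, MC₁ + MC₂, MB₁ + MB₂, _, _, hC₁.append hC₂, hB₁.append hB₂, by omega, by omega, ?_⟩
    subst hM₁; subst hM₂; subst hμ₁; subst hμ₂
    exact lconv_interchange MC₁ MB₁ MC₂ MB₂ μC₁ μB₁ μC₂ μB₂
  | @gate x₀ n₀ M₀ μ₀ q hq0 hq1 h _ =>
    obtain ⟨hx0, hx1, _, _, _, _⟩ := h.lawFacts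
    have hqx0 : 0 < q * x₀ := mul_pos hq0 hx0
    have hqx1 : q * x₀ < 1 := by nlinarith
    obtain ⟨_, _, _, hgM, _, _⟩ := (TreeBuiltN.gate q hq0 hq1 h).lawFacts
    have hv : ∀ k, 0 + M₀ < k → lconv 0 M₀ (fun h => if h = 0 then (1 : ℝ) else 0) (LawDec.gate μ₀ q) k = 0 := by
      intro k hk; rw [lconv_delta_left 0 M₀ _ hgM k]; exact hgM k (by omega)
    by_cases hpt : ∃ K : ℕ, μ₀ = fun h => if h = K then (1 : ℝ) else 0
    · -- a BLOB sibling: `μ₀ = δ_K`, and `K = M₀` (the top atom of a tree-built law is charged)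
      obtain ⟨K, hK⟩ := hpt
      subst hK
      have hKM : K = M₀ := by
        by_contra hne
        have htop : (0 : ℝ) < (if M₀ = K then (1 : ℝ) else 0) := h.top_pos
        rw [if_neg (Ne.symm hne)] at htop
        exact lt_irrefl _ htop
      subst hKM
      refine ⟨0, 0, 0, 0 + K, _, _, CompForestN.nil (q * x₀) hqx0 hqx1,
        BlobForest.blob (BlobForest.nil (q * x₀) hqx0 hqx1) q hq0 hq1.le le_rfl h, by omega, by omega, ?_⟩
      funext k
      rw [lconv_delta_left 0 (0 + K) _ hv k, lconv_delta_left 0 K _ hgM k]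
    · -- a COMPOSITE sibling
      have hnp : ∀ K : ℕ, μ₀ ≠ fun h => if h = K then (1 : ℝ) else 0 := fun K hK => hpt ⟨K, hK⟩
      refine ⟨0 + 1, 0 + (n₀ + 1), 0 + M₀, 0, _, _,
        CompForestN.tree (CompForestN.nil (q * x₀) hqx0 hqx1) q hq0 hq1 le_rfl h hnp, BlobForest.nil (q * x₀) hqx0 hqx1,
        by omega, by omega, ?_⟩
      funext k
      rw [lconv_delta_right (0 + M₀) 0 _ hv k, lconv_delta_left 0 M₀ _ hgM k]
  | mono _ hx'0 hxx ih =>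
    obtain ⟨k, nC, MC, MB, μC, μB, hC, hB, hn, hM, hμ⟩ := ih
    exact ⟨k, nC, MC, MB, μC, μB, hC.mono hx'0 hxx, hB.mono hx'0 hxx, hn, hM, hμ⟩

/-! ### The node: the sibling step -/
/-- **CONJECTURE (THE SIBLING STEP — the open core of R8-light as one node; spec lead g42 LEAD-NOTES-G42 N4, typed by typer g39).**  For a
forest of `k ≥ 3` COMPOSITE sibling trees at floor `x` (`CompForestN x n M μ k`: siblings `gate ρᵢ qᵢ`, `0 < qᵢ < 1`, `ρᵢ` tree-built at a
floor `xᵢ ≥ x/qᵢ` and not a point mass, `n = Σ (nᵢ + 1)` nontrivial gates): IF every tree-built law with FEWER than `n` nontrivial gates is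
SDEC at its floor (the induction hypothesis of the gate-elimination induction — it covers every proper sub-forest, every `ρᵢ`, and every
opened / re-gated / re-hung forest on fewer gates), THEN `μ` is SDEC at `x`.  KERNEL FACTS (this file): with the blob gate step CW
(`GatedSliceMixLaw'`, ✓ `gatedSliceMixLaw'_holds`) this node implies `GateStepN` (blob and relay siblings are absorbed by the slice theorems,
one composite sibling by `sdec_gate`, two by arm-1's two-root identity `gateStepN_of_tree`; `gateStepN_of_siblingStep`), hence
`SDECConvClosedTB`, `TreeBuiltDEC`, `Quant.FarTreeRow`; conversely `GateStepNCore ⟹ SiblingStep` (`siblingStep_of_gateStepNCore`) — the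
weakest node of the lane.  MINIMAL OPEN INSTANCE: three 2-chains (README V393).  EVIDENCE: count-level re-gating mixtures certify every
tested instance (README V394–V400, 0 / ≈ 11 500), pattern level generic-feasible (V405), the generic cherry identity (V404, ✓ p396159).
builds on p205010 (kernel theorem, internal audit signed; external expert review pending). [this work] [status: open] -/
@[conjecture] def SiblingStep : Prop :=
  ∀ (x : ℝ) (n M k : ℕ) (μ : ℕ → ℝ), 3 ≤ k → CompForestN x n M μ k →
    (∀ (x' : ℝ) (n' M' : ℕ) (μ' : ℕ → ℝ), n' < n → TreeBuiltN x' n' M' μ' → SDEC x' M' μ') →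
    SDEC x M μ

/-- `GateStepN ⟹ SiblingStep` (under `GateStepN` every tree-built law is SDEC, `sdec_of_treeBuiltN`). [this work] -/
theorem siblingStep_of_gateStepN (hG : GateStepN) : SiblingStep :=
  fun _ _ _ _ _ _ hF _ => sdec_of_treeBuiltN hG hF.treeBuiltN

/-- **`GateStepNCore ⟹ SiblingStep`**: a forest of `k ≥ 3` composite siblings is "(the first `k − 1` siblings, a genuine convolution) beside a
non-blob tree", with the budget its own gate count. [this work] -/
theorem siblingStep_of_gateStepNCore (hC : GateStepNCore) : SiblingStep := by
  intro x n M k μ hk hF hO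
  cases hF with
  | nil _ _ => omega
  | @tree n₀ M₀ k₀ μ₀ hF₁ x₁ n₁ M₁ ρ₁ q₁ hq₁0 hq₁1 hxq₁ hρ₁ hnp₁ =>
    cases hF₁ with
    | nil _ _ => omega
    | @tree n₀' M₀' k₀' μ₀' hF₂ x₂ n₂ M₂ ρ₂ q₂ hq₂0 hq₂1 hxq₂ hρ₂ _ =>
      have hx0 : 0 < x := hF₂.floor.1
      obtain ⟨_, hx₁1, _, _, _, _⟩ := hρ₁.lawFacts
      have hxg : x < q₁ := lt_of_le_of_lt hxq₁ (by nlinarith)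
      have ha : TreeBuiltN x n₀' M₀' μ₀' := hF₂.treeBuiltN
      have hb : TreeBuiltN x (n₂ + 1) M₂ (gate ρ₂ q₂) := TreeBuiltN.mono (TreeBuiltN.gate q₂ hq₂0 hq₂1 hρ₂) hx0 hxq₂
      have hc : TreeBuiltN (x / q₁) n₁ M₁ ρ₁ :=
        TreeBuiltN.mono hρ₁ (div_pos hx0 hq₁0) (by rw [div_le_iff₀ hq₁0]; linarith [mul_comm q₁ x₁])
      exact hC _ x q₁ n₀' (n₂ + 1) n₁ M₀' M₂ M₁ μ₀' (gate ρ₂ q₂) ρ₁ hO (by omega) hx0 hxg hq₁1 ha hb hc hnp₁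

/-- **A COMPOSITE FOREST IS SDEC under the oracle below a budget `N ≥` its gate count** — width `0`: nothing; width `1`: the oracle on the
sub-forest and `sdec_gate`; width `2`: arm-1's two-root identity (`gateStepN_of_tree`); width `≥ 3`: THE NODE. [this work] -/
theorem sdec_compForestN_of_siblingStep (hS : SiblingStep) (N : ℕ)
    (hO : ∀ (x' : ℝ) (n' M' : ℕ) (μ' : ℕ → ℝ), n' < N → TreeBuiltN x' n' M' μ' → SDEC x' M' μ')
    {x : ℝ} {n M k : ℕ} {μ : ℕ → ℝ} (hF : CompForestN x n M μ k) (hn : n ≤ N) : SDEC x M μ := by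
  have hF0 := hF
  cases hF with
  | nil _ _ =>
    intro q _ _ j' hj; omega
  | @tree n₀ M₀ k₀ μ₀ hF₁ x₁ n₁ M₁ ρ₁ q₁ hq₁0 hq₁1 hxq₁ hρ₁ _ =>
    obtain ⟨hx₁0, hx₁1, _, _, _, _⟩ := hρ₁.lawFacts
    obtain ⟨_, _, _, hg₁M, _, _⟩ := (TreeBuiltN.gate q₁ hq₁0 hq₁1 hρ₁).lawFacts
    have hqx₁ : q₁ * x₁ < 1 := by nlinarith
    cases hF₁ with
    | nil hx0 _ =>
      -- width 1: `δ₀ ∗ gate ρ₁ q₁ = gate ρ₁ q₁`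
      have e : lconv 0 M₁ (fun h => if h = 0 then (1 : ℝ) else 0) (gate ρ₁ q₁) = gate ρ₁ q₁ :=
        funext fun h => lconv_delta_left 0 M₁ _ hg₁M h
      rw [e, Nat.zero_add]
      have hSρ : SDEC x₁ M₁ ρ₁ := hO x₁ n₁ M₁ ρ₁ (by omega) hρ₁
      exact sdec_mono (sdec_gate hSρ q₁ hq₁0 hq₁1.le) hxq₁ hqx₁
    | @tree n₀' M₀' k₀' μ₀' hF₂ x₂ n₂ M₂ ρ₂ q₂ hq₂0 hq₂1 hxq₂ hρ₂ _ =>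
      obtain ⟨_, _, _, hg₂M, _, _⟩ := (TreeBuiltN.gate q₂ hq₂0 hq₂1 hρ₂).lawFacts
      cases hF₂ with
      | nil hx0 _ =>
        -- width 2: the two-root identity fed by the oracle
        have e : lconv 0 M₂ (fun h => if h = 0 then (1 : ℝ) else 0) (gate ρ₂ q₂) = gate ρ₂ q₂ :=
          funext fun h => lconv_delta_left 0 M₂ _ hg₂M h
        rw [e, Nat.zero_add]
        have hxg : x < q₁ := lt_of_le_of_lt hxq₁ (by nlinarith)
        have hc : TreeBuiltN (x / q₁) n₁ M₁ ρ₁ :=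
          TreeBuiltN.mono hρ₁ (div_pos hx0 hq₁0) (by rw [div_le_iff₀ hq₁0]; linarith [mul_comm q₁ x₁])
        exact gateStepN_of_tree N x q₁ q₂ x₂ n₂ n₁ M₂ M₁ ρ₂ ρ₁ hO (by omega) hx0 hxg hq₁1 hq₂0 hq₂1 hxq₂ hρ₂ hc
      | tree _ _ _ _ _ _ _ =>
        -- width ≥ 3: THE NODE, with the forest's own gate count as budget
        exact hS x _ _ _ _ (by omega) hF0 (fun x' n' M' μ' hlt h' => hO x' n' M' μ' (by omega) h')

/-- **A BLOB FOREST beside an SDEC tree-built law is absorbed** (the blob slice theorem `sdec_slice_blob_of_mixLaw'` — CW, given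
`GatedSliceMixLaw'` — once per blob; `K = 0` blobs are nothing). [this work] -/
theorem sdec_lconv_blobForest (hL : GatedSliceMixLaw') {x : ℝ} {n M : ℕ} {μ : ℕ → ℝ} (hT : TreeBuiltN x n M μ) (hS : SDEC x M μ)
    {MB : ℕ} {μB : ℕ → ℝ} (hB : BlobForest x MB μB) : SDEC x (M + MB) (lconv M MB μ μB) := by
  induction hB with
  | nil hx0 hx1 =>
    obtain ⟨_, _, _, hμM, _, _⟩ := hT.lawFacts
    have e : lconv M 0 μ (fun h => if h = 0 then (1 : ℝ) else 0) = μ := funext fun h => lconv_delta_right M 0 μ hμM h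
    rw [e]; exact hS
  | @blob M' μ' hB' x₁ n₁ K q hq0 hq1 hxq hρ ih =>
    obtain ⟨nB, hTB⟩ := hB'.exists_treeBuiltN
    obtain ⟨hx0, hx1, h0, hM2, h1, hta⟩ := (TreeBuiltN.conv hT hTB).lawFacts
    obtain ⟨_, hx₁1, _, _, _, _⟩ := hρ.lawFacts
    have hS2 : SDEC x (M + M') (lconv M M' μ μ') := ih
    have hxq' : x ≤ q := le_trans hxq (by nlinarith)
    rw [show M + (M' + K) = M + M' + K from (Nat.add_assoc _ _ _).symm, lconv_assoc,
      lconv_gate_point_eq_slice (M + M') K _ q hM2]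
    rcases Nat.eq_zero_or_pos K with hK | hK
    · subst hK
      have e : slice (lconv M M' μ μ') 0 q = lconv M M' μ μ' := by
        funext h; simp only [slice, Nat.zero_le, if_true, Nat.sub_zero]; ring
      rw [e]; exact hS2
    · exact sdec_slice_blob_of_mixLaw' hL x q (M + M') K _ hx0 hx1 hxq' hq1 hK h0 hM2 h1 hta hS2

/-- **EVERY TREE-BUILT LAW IS SDEC, under `GatedSliceMixLaw' ∧ SiblingStep`** (strong induction on the gate count; the forest normal form,
the composite part by width, the blob part by slicing). [this work] -/
theorem sdec_of_treeBuiltN_of_siblingStep (hL : GatedSliceMixLaw') (hS : SiblingStep) {x : ℝ} {n M : ℕ} {μ : ℕ → ℝ}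
    (h : TreeBuiltN x n M μ) : SDEC x M μ := by
  have key : ∀ m : ℕ, ∀ (x' : ℝ) (n' M' : ℕ) (μ' : ℕ → ℝ), n' ≤ m → TreeBuiltN x' n' M' μ' → SDEC x' M' μ' := by
    intro m
    induction m using Nat.strong_induction_on with
    | _ m ihm =>
      intro x' n' M' μ' hle h'
      have hO : ∀ (x'' : ℝ) (n'' M'' : ℕ) (μ'' : ℕ → ℝ), n'' < m → TreeBuiltN x'' n'' M'' μ'' → SDEC x'' M'' μ'' :=
        fun x'' n'' M'' μ'' hlt h'' => ihm n'' hlt x'' n'' M'' μ'' le_rfl h''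
      obtain ⟨k, nC, MC, MB, μC, μB, hC, hB, hnC, hM, hμ⟩ := h'.partition
      subst hM; subst hμ
      exact sdec_lconv_blobForest hL hC.treeBuiltN (sdec_compForestN_of_siblingStep hS m hO hC (by omega)) hB
  exact key n x n M μ le_rfl h

/-- **`GatedSliceMixLaw' ∧ SiblingStep ⟹ GateStepN`** (the forest beside the new tree is tree-built, hence SDEC). [this work] -/
theorem gateStepN_of_siblingStep (hL : GatedSliceMixLaw') (hS : SiblingStep) : GateStepN := by
  intro n x g n₁ n₂ M₁ M₂ μ₁ c _ _ hx0 hxg hg1 h₁ hc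
  have hg0 : 0 < g := lt_trans hx0 hxg
  have hgc : TreeBuiltN (g * (x / g)) (n₂ + 1) M₂ (gate c g) := TreeBuiltN.gate g hg0 hg1 hc
  rw [mul_div_cancel₀ x hg0.ne'] at hgc
  exact sdec_of_treeBuiltN_of_siblingStep hL hS (TreeBuiltN.conv h₁ hgc)

/-- **`GatedSliceMixLaw' ∧ SiblingStep ⟹ SDECConvClosedTB`**. [this work] -/
theorem sdecConvClosedTB_of_siblingStep (hL : GatedSliceMixLaw') (hS : SiblingStep) : SDECConvClosedTB :=
  sdecConvClosedTB_of_gateStepN (gateStepN_of_siblingStep hL hS)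

/-- **`GatedSliceMixLaw' ∧ SiblingStep ⟹ TreeBuiltDEC`**. [this work] -/
theorem treeBuiltDEC_of_siblingStep (hL : GatedSliceMixLaw') (hS : SiblingStep) : TreeBuiltDEC :=
  treeBuiltDEC_of_gateStepN (gateStepN_of_siblingStep hL hS)

/-! ### Unconditional forms: the blob gate step CW is a theorem of the tree (`gatedSliceMixLaw'_holds`) -/
/-- **EVERY TREE-BUILT LAW IS SDEC under `SiblingStep` alone** (CW fed in). [this work] -/
theorem sdec_of_treeBuiltN_of_siblingStep' (hS : SiblingStep) {x : ℝ} {n M : ℕ} {μ : ℕ → ℝ} (h : TreeBuiltN x n M μ) :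
    SDEC x M μ :=
  sdec_of_treeBuiltN_of_siblingStep gatedSliceMixLaw'_holds hS h

/-- **`SiblingStep ⟹ GateStepN`, unconditionally**. [this work] -/
theorem gateStepN_of_siblingStep' (hS : SiblingStep) : GateStepN :=
  gateStepN_of_siblingStep gatedSliceMixLaw'_holds hS

/-- **`SiblingStep ↔ GateStepN`** (no side hypothesis): the sibling step IS the gate step with the full induction hypothesis. [this work] -/
theorem siblingStep_iff_gateStepN : SiblingStep ↔ GateStepN :=
  ⟨gateStepN_of_siblingStep', siblingStep_of_gateStepN⟩

/-- **`SiblingStep ↔ GateStepNCore`** (no side hypothesis). [this work] -/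
theorem siblingStep_iff_gateStepNCore : SiblingStep ↔ GateStepNCore :=
  ⟨fun hS => gateStepNCore_of_gateStepN (gateStepN_of_siblingStep' hS), siblingStep_of_gateStepNCore⟩

/-- **`SiblingStep ⟹ SDECConvClosedTB`, unconditionally**. [this work] -/
theorem sdecConvClosedTB_of_siblingStep' (hS : SiblingStep) : SDECConvClosedTB :=
  sdecConvClosedTB_of_siblingStep gatedSliceMixLaw'_holds hS

end LawDec

/-- **`GatedSliceMixLaw' ∧ SiblingStep ⟹ Quant.FarTreeRow`** — the R8 tree row from the blob gate step (CW) and the SIBLING STEP (a forest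
of `k ≥ 3` composite sibling trees under the induction hypothesis). [this work] -/
theorem farTreeRow_of_siblingStep (hL : LawDec.GatedSliceMixLaw') (hS : LawDec.SiblingStep) : FarTreeRow :=
  farTreeRow_of_gateStepN (LawDec.gateStepN_of_siblingStep hL hS)

/-- **`SiblingStep ⟹ Quant.FarTreeRow`, UNCONDITIONALLY** — in the kernel the R8 tree row (`Quant.FarTreeRow`, hence the light half of rung
R8 along this route) follows from the sibling step alone: SDEC of every forest of `k ≥ 3` composite sibling trees, given SDEC of every
tree-built law on fewer nontrivial gates. [this work] -/
theorem farTreeRow_of_siblingStep' (hS : LawDec.SiblingStep) : FarTreeRow :=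
  farTreeRow_of_siblingStep LawDec.gatedSliceMixLaw'_holds hS

end Quant
end Summit.CriticalPhenomena.PercolationContinuityZ3.Theorems
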